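import Summits.ResolutionOfSingularities.ResolutionOfSingularities.Theorems.WeightedInvariantContactCylinderConsistency
import Summits.ResolutionOfSingularities.ResolutionOfSingularities.Theorems.WeightedInvariantContactCentreFiltrationBasic
import Summits.ResolutionOfSingularities.ResolutionOfSingularities.Theorems.WeightedInvariantIotaOrder
import Summits.ResolutionOfSingularities.ResolutionOfSingularities.Theorems.WeightedInvariantHypersurfaceLocalGameEFT3
import Mathlib.RingTheory.Localization.AtPrime.Basic
import HarnessLib

/-!
# Transport of the cylinder construction `jCylinder ι J`: unit invariance and iso invariance
# (door `HypersurfaceCentreConstruction`, stmt-ResolutionOfSingularities-19897; KEY `stub_localWeightedDropEFT4S`, P3 rung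
# `stub_keyRung_dimLEThree` of skeleton v3.7 / the ladder `PRung d` p522114; res-type-061, OFFER (o29-b) 2026-08-27T11:00:40Z)

Topic: `Summits/ResolutionOfSingularities/ResolutionOfSingularities/Theorems`. Helper for the door item `HypersurfaceCentreConstruction`
(`--supports stmt-ResolutionOfSingularities-19897 --as helper`), def-free.  For ANY local invariant `ι` and ANY centre filtration `J` in
the binder shapes of the clauses of `…HypersurfaceLocalGameEFT3`, res-type-005's cylinder construction `ContactCylinder.jCylinder ι J`
(p524206, ORDER (o28) (D1)) inherits the two TRANSPORT clauses of the rung `PRung d`: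

* `jCylinder_unitInvariant : IotaUnitInvariant ι → JUnitInvariant J → JUnitInvariant (jCylinder ι J)` — the top `ι`-stratum of `v·f`
  is the top `ι`-stratum of `f` (`v/1` is a unit in every `R_𝔮`), and `J` is unit-invariant inside `R_P`;
* `jCylinder_isoInvariant : IotaIsoInvariant ι → JIsoInvariant J → JIsoInvariant (jCylinder ι J)` — a ring isomorphism `e : R ≃+* T`
  carries the top stratum (`𝔮' ↦ e⁻¹𝔮'`), hence its generic prime (`topStratumPrime ι T (e f) = (topStratumPrime ι R f).map e`), and
  `R_P ≃+* T_{eP}` (Mathlib `IsLocalization.ringEquivOfRingEquiv`) carries the cylinder: `cylinderAt J T (eP) (e f) m = (cylinderAt J R P f m).map e`.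

USE: for the P3 pair of record `(ι₃, J₃ := jCylinder ι₃ jContact)` (IOTA3-DESIGN of res-L1-w43-plan-1), the `PRung 3` conjuncts
`JIsoInvariant J₃` / `JUnitInvariant J₃` are `jCylinder_isoInvariant hι₃ jContact_isoInvariant` / `jCylinder_unitInvariant hι₃' jContact_unitInvariant`
(092's `…ContactCentreFiltrationBasic`), whatever `ι₃` is.  Pure transport of structure; no mathematics of the line.

[OURS · L1 W4.3 · kernel plumbing; nothing here asserts anything about Hironaka's problem; NOT a statement of the manuscript under review
(Hironaka 2017, [claim: Hironaka2017, status: under-review]); AI work, weaker than expert review.]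
-/

noncomputable section

open IsLocalRing
open Summit.ResolutionOfSingularities.ResolutionOfSingularities.Cruxes.HypersurfaceCentreConstruction.LocalEngine

set_option linter.dupNamespace false -- mandated namespace of this single-conjunct summit

namespace Summit.ResolutionOfSingularities.ResolutionOfSingularities.Theorems

namespace ContactCylinder

/-! ## A congruence for the dependent `if` in `jCylinder` (the prime-level congruence `cylinderAt_congr` is res-type-005's, p526235) -/

open Classical in
/-- `jCylinder ι J R f m` only depends on the generic prime of the top stratum: if `topStratumPrime ι R f = P` then it is the
cylinder over `P` when `P` is prime and `⊤` otherwise. [folklore] -/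
theorem jCylinder_eq_dite (ι : (R : Type) → [CommRing R] → R → Ordinal.{0}) (J : (R : Type) → [CommRing R] → R → ℕ → Ideal R)
    (R : Type) [CommRing R] (f : R) (m : ℕ) {P : Ideal R} (hP : topStratumPrime ι R f = P) :
    jCylinder ι J R f m = if h : P.IsPrime then @cylinderAt J R _ P h f m else ⊤ := by
  subst hP
  rfl

/-! ## Unit invariance -/

section Unit

variable (ι : (R : Type) → [CommRing R] → R → Ordinal.{0}) (J : (R : Type) → [CommRing R] → R → ℕ → Ideal R)

/-- The top `ι`-stratum of `v·f` is the top `ι`-stratum of `f` for a unit `v` (unit invariance of `ι` in `R` and in every `R_𝔮`,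
where `v/1` is again a unit). [folklore] -/
theorem topStratum_unit_mul (hι : IotaUnitInvariant ι) (R : Type) [CommRing R] {v : R} (hv : IsUnit v) (f : R) :
    topStratum ι R (v * f) = topStratum ι R f := by
  ext 𝔮
  rw [mem_topStratum_iff, mem_topStratum_iff, map_mul, hι _ _ _ (hv.map _), hι _ _ _ hv]

/-- … hence so is its generic prime. [folklore] -/
theorem topStratumPrime_unit_mul (hι : IotaUnitInvariant ι) (R : Type) [CommRing R] {v : R} (hv : IsUnit v) (f : R) :
    topStratumPrime ι R (v * f) = topStratumPrime ι R f := by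
  unfold topStratumPrime
  rw [topStratum_unit_mul ι hι R hv f]

/-- The cylinder over a fixed prime is unit-invariant when `J` is. [folklore] -/
theorem cylinderAt_unit_mul (hJ : JUnitInvariant J) (R : Type) [CommRing R] (P : Ideal R) [P.IsPrime] {v : R} (hv : IsUnit v)
    (f : R) (m : ℕ) : cylinderAt J R P (v * f) m = cylinderAt J R P f m := by
  rw [cylinderAt_def, cylinderAt_def, map_mul, hJ _ _ _ m (hv.map _)]

/-- **`jCylinder ι J` is unit-invariant** as soon as `ι` and `J` are: the clause `JUnitInvariant (jCylinder ι J)` of `PRung d`.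
[OURS · L1 W4.3 · (o29-b)] -/
theorem jCylinder_unitInvariant (hι : IotaUnitInvariant ι) (hJ : JUnitInvariant J) : JUnitInvariant (jCylinder ι J) := by
  intro R _ v g m hv
  have hP : topStratumPrime ι R (v * g) = topStratumPrime ι R g := topStratumPrime_unit_mul ι hι R hv g
  rw [jCylinder_eq_dite ι J R (v * g) m hP, jCylinder_eq_dite ι J R g m rfl]
  by_cases h : (topStratumPrime ι R g).IsPrime
  · rw [dif_pos h, dif_pos h]
    exact cylinderAt_unit_mul J hJ R _ hv g m
  · rw [dif_neg h, dif_neg h]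

end Unit

/-! ## Iso invariance -/

section Iso

variable (ι : (R : Type) → [CommRing R] → R → Ordinal.{0}) (J : (R : Type) → [CommRing R] → R → ℕ → Ideal R)
variable {R T : Type} [CommRing R] [CommRing T] (e : R ≃+* T)

/-- Along a ring isomorphism `e : R ≃+* T`, the complement of `e⁻¹Q` maps onto the complement of `Q`. [folklore] -/
theorem primeCompl_comap_map_ringEquiv (Q : Ideal T) [Q.IsPrime] :
    (Q.comap (e : R →+* T)).primeCompl.map e.toMonoidHom = Q.primeCompl := by
  ext t
  constructor
  · rintro ⟨r, hr, rfl⟩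
    exact hr
  · intro ht
    refine ⟨e.symm t, ?_, ?_⟩
    · change e (e.symm t) ∉ Q
      rw [e.apply_symm_apply]
      exact ht
    · change e (e.symm t) = t
      exact e.apply_symm_apply t

/-- The induced isomorphism of localisations `R_{e⁻¹Q} ≃+* T_Q` sends `f/1` to `e(f)/1`. [folklore] -/
theorem ringEquivOfRingEquiv_atPrime_apply (Q : Ideal T) [Q.IsPrime] (f : R) :
    IsLocalization.ringEquivOfRingEquiv (M := (Q.comap (e : R →+* T)).primeCompl) (T := Q.primeCompl)
        (Localization.AtPrime (Q.comap (e : R →+* T))) (Localization.AtPrime Q) e (primeCompl_comap_map_ringEquiv e Q)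
        (algebraMap R (Localization.AtPrime (Q.comap (e : R →+* T))) f) =
      algebraMap T (Localization.AtPrime Q) (e f) :=
  IsLocalization.ringEquivOfRingEquiv_eq _ f

/-- … and its inverse sends `t/1` to `e⁻¹(t)/1`. [folklore] -/
theorem ringEquivOfRingEquiv_atPrime_symm_apply (Q : Ideal T) [Q.IsPrime] (t : T) :
    (IsLocalization.ringEquivOfRingEquiv (M := (Q.comap (e : R →+* T)).primeCompl) (T := Q.primeCompl)
        (Localization.AtPrime (Q.comap (e : R →+* T))) (Localization.AtPrime Q) e (primeCompl_comap_map_ringEquiv e Q)).symm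
        (algebraMap T (Localization.AtPrime Q) t) =
      algebraMap R (Localization.AtPrime (Q.comap (e : R →+* T))) (e.symm t) := by
  rw [RingEquiv.symm_apply_eq, ringEquivOfRingEquiv_atPrime_apply, RingEquiv.apply_symm_apply]

/-- **The top stratum is transported by a ring isomorphism**: `Q ∈ topStratum ι T (e f) ↔ e⁻¹Q ∈ topStratum ι R f`.
[folklore] -/
theorem mem_topStratum_ringEquiv_iff (hι : IotaIsoInvariant ι) (f : R) (Q : PrimeSpectrum T) :
    Q ∈ topStratum ι T (e f) ↔ (⟨Q.asIdeal.comap (e : R →+* T), inferInstance⟩ : PrimeSpectrum R) ∈ topStratum ι R f := by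
  rw [mem_topStratum_iff, mem_topStratum_iff, hι R T e f, ← ringEquivOfRingEquiv_atPrime_apply e Q.asIdeal f,
    hι _ _ (IsLocalization.ringEquivOfRingEquiv _ _ e _)]

/-- **The generic prime of the top stratum is transported**: `topStratumPrime ι T (e f) = (topStratumPrime ι R f).comap e⁻¹`
(`= (topStratumPrime ι R f).map e`). [folklore] -/
theorem topStratumPrime_ringEquiv (hι : IotaIsoInvariant ι) (f : R) :
    topStratumPrime ι T (e f) = (topStratumPrime ι R f).comap (e.symm : T →+* R) := by
  unfold topStratumPrime
  simp only [Ideal.comap_iInf]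
  apply le_antisymm
  · refine le_iInf fun 𝔮 => le_iInf fun h𝔮 => ?_
    have hmem : (⟨𝔮.asIdeal.comap (e.symm : T →+* R), inferInstance⟩ : PrimeSpectrum T) ∈ topStratum ι T (e f) := by
      rw [mem_topStratum_ringEquiv_iff ι e hι f]
      have : (𝔮.asIdeal.comap (e.symm : T →+* R)).comap (e : R →+* T) = 𝔮.asIdeal := by
        ext r
        simp only [Ideal.mem_comap, RingHom.coe_coe, RingEquiv.symm_apply_apply]
      -- the point `e⁻¹(e 𝔮) = 𝔮`
      have hpt : (⟨(𝔮.asIdeal.comap (e.symm : T →+* R)).comap (e : R →+* T), inferInstance⟩ : PrimeSpectrum R) = 𝔮 :=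
        PrimeSpectrum.ext this
      rw [hpt]
      exact h𝔮
    exact (iInf_le _ (⟨𝔮.asIdeal.comap (e.symm : T →+* R), inferInstance⟩ : PrimeSpectrum T)).trans (iInf_le _ hmem)
  · refine le_iInf fun Q => le_iInf fun hQ => ?_
    have hmem : (⟨Q.asIdeal.comap (e : R →+* T), inferInstance⟩ : PrimeSpectrum R) ∈ topStratum ι R f :=
      (mem_topStratum_ringEquiv_iff ι e hι f Q).mp hQ
    have hQ' : (Q.asIdeal.comap (e : R →+* T)).comap (e.symm : T →+* R) = Q.asIdeal := by
      ext t
      simp only [Ideal.mem_comap, RingHom.coe_coe, RingEquiv.apply_symm_apply]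
    calc ⨅ 𝔮 ∈ topStratum ι R f, 𝔮.asIdeal.comap (e.symm : T →+* R)
        ≤ (Q.asIdeal.comap (e : R →+* T)).comap (e.symm : T →+* R) :=
          (iInf_le _ (⟨Q.asIdeal.comap (e : R →+* T), inferInstance⟩ : PrimeSpectrum R)).trans (iInf_le _ hmem)
      _ = Q.asIdeal := hQ'

/-- **The cylinder over a prime is transported**: for `Q` a prime of `T`,
`cylinderAt J T Q (e f) m = (cylinderAt J R (e⁻¹Q) f m).comap e⁻¹` (`= (…).map e`). [folklore] -/
theorem cylinderAt_ringEquiv (hJ : JIsoInvariant J) (Q : Ideal T) [Q.IsPrime] (f : R) (m : ℕ) :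
    cylinderAt J T Q (e f) m = (cylinderAt J R (Q.comap (e : R →+* T)) f m).comap (e.symm : T →+* R) := by
  rw [cylinderAt_def, cylinderAt_def, ← ringEquivOfRingEquiv_atPrime_apply e Q f,
    hJ _ _ (IsLocalization.ringEquivOfRingEquiv (M := (Q.comap (e : R →+* T)).primeCompl) (T := Q.primeCompl)
      (Localization.AtPrime (Q.comap (e : R →+* T))) (Localization.AtPrime Q) e (primeCompl_comap_map_ringEquiv e Q)) _ m,
    ← Ideal.comap_symm]
  ext t
  simp only [Ideal.mem_comap, RingHom.coe_coe, ringEquivOfRingEquiv_atPrime_symm_apply]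

/-- **`jCylinder ι J` is iso-invariant** as soon as `ι` and `J` are: the clause `JIsoInvariant (jCylinder ι J)` of `PRung d`.
[OURS · L1 W4.3 · (o29-b)] -/
theorem jCylinder_isoInvariant (hι : IotaIsoInvariant ι) (hJ : JIsoInvariant J) : JIsoInvariant (jCylinder ι J) := by
  intro R T _ _ e g m
  have hP : topStratumPrime ι T (e g) = (topStratumPrime ι R g).comap (e.symm : T →+* R) := topStratumPrime_ringEquiv ι e hι g
  rw [jCylinder_eq_dite ι J T (e g) m hP, jCylinder_eq_dite ι J R g m rfl, ← Ideal.comap_symm]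
  by_cases h : (topStratumPrime ι R g).IsPrime
  · haveI : ((topStratumPrime ι R g).comap (e.symm : T →+* R)).IsPrime := Ideal.comap_isPrime _ _
    rw [dif_pos this, dif_pos h, cylinderAt_ringEquiv J e hJ _ g m]
    have hQ : ((topStratumPrime ι R g).comap (e.symm : T →+* R)).comap (e : R →+* T) = topStratumPrime ι R g := by
      ext r
      simp only [Ideal.mem_comap, RingHom.coe_coe, RingEquiv.symm_apply_apply]
    rw [cylinderAt_congr J R hQ g m]
    exact Ideal.ext fun _ => Iff.rfl
  · have h' : ¬ ((topStratumPrime ι R g).comap (e.symm : T →+* R)).IsPrime := by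
      intro hc
      apply h
      have hQ : ((topStratumPrime ι R g).comap (e.symm : T →+* R)).comap (e : R →+* T) = topStratumPrime ι R g := by
        ext r
        simp only [Ideal.mem_comap, RingHom.coe_coe, RingEquiv.symm_apply_apply]
      rw [← hQ]
      exact Ideal.comap_isPrime _ _
    rw [dif_neg h', dif_neg h, Ideal.comap_top]

end Iso

/-! ## The cylinder over the P2 centre filtration `jContact` (the P3 candidate `J₃ := jCylinder ι₃ jContact`) -/

section JContact

variable (ι : (R : Type) → [CommRing R] → R → Ordinal.{0})

/-- **`JUnitInvariant (jCylinder ι jContact)`** for every unit-invariant `ι` (092's `jContact_unitInvariant`): the (c12-J) conjunct of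
`PRung 3` for the pair of record `(ι₃, jCylinder ι₃ jContact)`, whatever `ι₃` is. [OURS · L1 W4.3 · (o29-b)] -/
theorem jCylinder_jContact_unitInvariant (hι : IotaUnitInvariant ι) : JUnitInvariant (jCylinder ι jContact) :=
  jCylinder_unitInvariant ι jContact hι jContact_unitInvariant

/-- **`JIsoInvariant (jCylinder ι jContact)`** for every iso-invariant `ι` (092's `jContact_isoInvariant`): the (c5) conjunct of
`PRung 3` for the pair of record `(ι₃, jCylinder ι₃ jContact)`, whatever `ι₃` is. [OURS · L1 W4.3 · (o29-b)] -/
theorem jCylinder_jContact_isoInvariant (hι : IotaIsoInvariant ι) : JIsoInvariant (jCylinder ι jContact) :=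
  jCylinder_isoInvariant ι jContact hι jContact_isoInvariant

/-- In particular for the first letter `iotaOrd` (iso- and unit-invariant: `iotaOrd_isoInvariant`, `iotaOrd_unitInvariant`):
`jCylinder iotaOrd jContact` is iso- and unit-invariant. [OURS · L1 W4.3 · (o29-b)] -/
theorem jCylinder_iotaOrd_jContact_invariant :
    JIsoInvariant (jCylinder iotaOrd jContact) ∧ JUnitInvariant (jCylinder iotaOrd jContact) :=
  ⟨jCylinder_jContact_isoInvariant iotaOrd iotaOrd_isoInvariant, jCylinder_jContact_unitInvariant iotaOrd iotaOrd_unitInvariant⟩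

end JContact

end ContactCylinder

end Summit.ResolutionOfSingularities.ResolutionOfSingularities.Theorems

end
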